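import Mathlib
import HarnessLib
import Summits.Ventures.LatticeQCDFlow.Scoring.IndepMHKernelPositive
import Summits.Ventures.LatticeQCDFlow.Scoring.ChainTimeAverage
import Summits.Ventures.LatticeQCDFlow.Scoring.DoeblinGreenKubo

/-!
# The acceptance record of the exact flow-MCMC chain is super-binomial

HONEST FRAMING: exact (Metropolis-corrected) sampling algorithms for lattice gauge theory;
figures of merit are autocorrelation/cost numbers at stated couplings and volumes; no
continuum-physics claim.

Venture `LatticeQCDFlow` (cell pub-lqcd), topic `Scoring`; flow / samplers seat (GEN-35; the typed
law behind its registered prediction "acceptance scatter across streams is super-binomial").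
NEW WORK of the cell, not a published result; nothing here is cited as a fact.  Printed
counterparts NAMED ONLY: Liu 1996 / Liu 2001 §5.4 (Metropolized independence sampling),
Tierney 1994 (Metropolis–Hastings kernels on general spaces).  Bookkeeping over Mathlib's
`Kernel.map` / `Kernel.prodMkRight` / `Measure.bind` / `Kernel.trajMeasure`, row 30's
`Exactness.indepMH`, row 8's `kop` / `autocov` / `chain_covariance`, row 11's
`variance_sum_range_of_cov_eq`, and `indepMH_autocov_nonneg`.  Sibling, NOT the same chain: row 8's
`RestartChainAutocorrelation.lean` records a function of the NEW state; here the record is the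
transition's own accept flag, whence the lag shift `t + 1 ↔ t`.

Setting: measurable `Ω`; MODEL `q` (the flow's output law); TARGET `π = w · q`, `w > 0`
measurable; `a(x, y) = min{1, w y / w x}`; `α(x) = ∫ a(x, y) dq(y) = (imhAcceptMass q w x).toReal`
the LOCAL ACCEPTANCE RATE; `ā = ∫ α dπ`; `K = indepMH q w`; `C_α(t) = autocov K π (α − ā) t`.
* `imhRecord q w : Kernel Ω (Ω × Bool)` — one flow-MCMC step from `x` WITH ITS FLAG (`(y, true)`
  on accept, `(x, false)` on reject); `map_fst_imhRecord`: forgetting the flag gives `K`.  The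
  RECORD CHAIN `Z_n = (X_n, A_n)` is `K̂ = Kernel.prodMkRight Bool (imhRecord q w)`; `acceptFlag`
  is the `0/1` observable `A`; `π̂ = imhRecord q w ∘ₘ π` is `K̂`-invariant (`imhRecord_invariant`);
  `imhRecordPath` is the path law of the record chain started in `π̂`.
* `iterate_kop_imhRecord_acceptFlag`: `(kop K̂)^[t+1] A = ((kop K)^[t] α) ∘ fst` (`t = 0`: the
  flag's conditional mean is `α(X_n)`); `integral_acceptFlag_mul`: `∫ A·(H ∘ fst) dπ̂ = ∫ α H dπ`.
* **`autocov_acceptFlag_succ`** (THE RECORD LAW): `autocov K̂ π̂ A (t + 1) = autocov K π α t`;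
  centred `C_A(t + 1) = C_α(t)`, `C_A(0) = ā(1 − ā)`, and `0 ≤ C_A(t + 1)` (`…_succ_nonneg`).
* PATH LEVEL (so `cov[A_i, A_{i+t+1}] = C_α(t)` by `chain_covariance`):
  **`variance_sum_acceptFlag`** `Var[Σ_{i<N} A_i] = N ā(1 − ā) + 2 Σ_{t<N} (N − (t+1)) C_α(t)`
  and **`variance_sum_acceptFlag_ge_binomial`** `Var[Σ_{i<N} A_i] ≥ N ā(1 − ā)` for EVERY flow,
  target, volume and `N`: the acceptance record of an exact flow sampler in equilibrium is never
  under-dispersed relative to i.i.d. coin flips at its own mean acceptance; the excess is a sum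
  of nonnegative terms whose `t = 0` term is `2 (N − 1) Var_π α`.
NOT CLAIMED: any number of ours; non-stationary starts; the finite-stream estimator; an upper
envelope (that needs a gap, cf. `variance_timeAverage_le_of_doeblin`).
-/

noncomputable section
namespace Summit.Ventures.LatticeQCDFlow.Scoring
open MeasureTheory ProbabilityTheory Filter Finset Summit.Ventures.LatticeQCDFlow.Exactness
open scoped ENNReal

variable {Ω : Type*} [MeasurableSpace Ω]
/-- **Centring by a constant** (`κ` Markov, `μ` invariant probability law, `f` bounded
measurable): `autocov κ μ (f − c) t = autocov κ μ f t − c (2 ∫ f dμ − c)`. -/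
theorem autocov_sub_const {κ : Kernel Ω Ω} [IsMarkovKernel κ] {μ : Measure Ω}
    [IsProbabilityMeasure μ] (hμ : Kernel.Invariant κ μ) {f : Ω → ℝ} (hf : Measurable f) {C : ℝ}
    (hC : ∀ x, |f x| ≤ C) (c : ℝ) (t : ℕ) :
    autocov κ μ (fun x => f x - c) t = autocov κ μ f t - c * (2 * ∫ x, f x ∂μ - c) := by
  obtain ⟨hm, hb⟩ := iterate_kop_bounded_measurable κ hf hC t
  have hIf : Integrable f μ := integrable_of_bounded μ hf hC
  have hIk : Integrable ((kop κ)^[t] f) μ := integrable_of_bounded μ hm hb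
  have hIfk : Integrable (fun x => f x * (kop κ)^[t] f x) μ :=
    integrable_of_bounded μ (hf.mul hm) (C := C * C) fun x => by
      rw [abs_mul]; exact mul_le_mul (hC x) (hb x) (abs_nonneg _) ((abs_nonneg _).trans (hC x))
  have hI0 : Integrable (fun x => (kop κ)^[t] f x + f x) μ := hIk.add hIf
  have hI1 : Integrable (fun x => (kop κ)^[t] f x + f x - c) μ := hI0.sub (integrable_const c)
  have hI2 : Integrable (fun x => c * ((kop κ)^[t] f x + f x - c)) μ := hI1.const_mul c
  unfold autocov
  rw [iterate_kop_sub_const (κ := κ) hf hC c t]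
  have hexp : ∀ x, (f x - c) * ((kop κ)^[t] f x - c)
      = f x * (kop κ)^[t] f x - c * ((kop κ)^[t] f x + f x - c) := fun x => by ring
  simp_rw [hexp]
  rw [integral_sub hIfk hI2, integral_const_mul, integral_sub hI0 (integrable_const c),
    integral_add hIk hIf, integral_iterate_kop κ hμ hf hC t, integral_const, probReal_univ,
    one_smul]
  ring

/-- ONE STEP OF FLOW-MCMC FROM `x` WITH ITS ACCEPT FLAG: propose `y ∼ q`; with probability
`min{1, w y / w x}` move to `(y, true)`, else stay, as `(x, false)`. -/
def imhRecord (q : Measure Ω) [IsProbabilityMeasure q] (w : Ω → ℝ) : Kernel Ω (Ω × Bool) :=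
  (Kernel.withDensity (Kernel.const Ω q) (imhAcceptE w)).map (fun y : Ω => (y, true)) +
    (Kernel.withDensity (Kernel.deterministic id measurable_id)
      (fun x _ => 1 - imhAcceptMass q w x)).map (fun x : Ω => (x, false))

/-- The accept flag of a record, as a real observable: `1` on `(·, true)`, `0` on `(·, false)`. -/
def acceptFlag (z : Ω × Bool) : ℝ := if z.2 then 1 else 0

omit [MeasurableSpace Ω] in
/-- `|A| ≤ 1`. -/
theorem abs_acceptFlag_le (z : Ω × Bool) : |acceptFlag z| ≤ 1 := by
  unfold acceptFlag; split_ifs <;> norm_num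

omit [MeasurableSpace Ω] in
/-- `A² = A`. -/
theorem acceptFlag_sq (z : Ω × Bool) : acceptFlag z ^ 2 = acceptFlag z := by
  unfold acceptFlag; split_ifs <;> norm_num

/-- `A` is measurable. -/
theorem measurable_acceptFlag : Measurable (acceptFlag : Ω × Bool → ℝ) := by
  unfold acceptFlag
  exact Measurable.ite (measurable_snd (measurableSet_singleton true)) measurable_const
    measurable_const

variable {q : Measure Ω} [IsProbabilityMeasure q] {w : Ω → ℝ}

/-- The local acceptance rate `α(x) = (imhAcceptMass q w x).toReal` is measurable … -/
theorem measurable_toReal_imhAcceptMass (hw : Measurable w) :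
    Measurable fun x => (imhAcceptMass q w x).toReal :=
  (measurable_imhAcceptMass q hw).ennreal_toReal

/-- … and lies in `[0, 1]`. -/
theorem abs_toReal_imhAcceptMass_le (x : Ω) : |(imhAcceptMass q w x).toReal| ≤ 1 := by
  rw [abs_of_nonneg ENNReal.toReal_nonneg]
  exact ENNReal.toReal_le_of_le_ofReal zero_le_one (ENNReal.ofReal_one ▸ imhAcceptMass_le_one q w x)

/-- The record kernel from `x` as a measure:
`imhRecord q w x = (a(x, ·) · q) ∘ (·, true)⁻¹ + (1 − A(x)) δ_{(x, false)}`. -/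
theorem imhRecord_apply_eq (hw : Measurable w) (x : Ω) :
    imhRecord q w x = (q.withDensity (imhAcceptE w x)).map (fun y : Ω => (y, true))
      + (1 - imhAcceptMass q w x) • Measure.dirac (x, false) := by
  have h2 : Measurable (Function.uncurry fun (x : Ω) (_ : Ω) => 1 - imhAcceptMass q w x) :=
    measurable_const.sub ((measurable_imhAcceptMass q hw).comp measurable_fst)
  rw [imhRecord, Kernel.add_apply, Kernel.map_apply _ (measurable_id'.prodMk measurable_const),
    Kernel.map_apply _ (measurable_id'.prodMk measurable_const),
    Kernel.withDensity_apply _ (measurable_imhAcceptE hw), Kernel.const_apply,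
    Kernel.withDensity_apply _ h2, Kernel.deterministic_apply, id, withDensity_const,
    Measure.map_smul, Measure.map_dirac' (measurable_id'.prodMk measurable_const)]

/-- **Forgetting the flag gives back the flow-MCMC kernel**: `fst_* (imhRecord x) = indepMH x`. -/
theorem map_fst_imhRecord (hw : Measurable w) (x : Ω) :
    (imhRecord q w x).map Prod.fst = indepMH q w x := by
  rw [imhRecord_apply_eq hw x, indepMH_apply_eq hw x, Measure.map_add _ _ measurable_fst,
    Measure.map_map measurable_fst (measurable_id'.prodMk measurable_const), Measure.map_smul,
    Measure.map_dirac' measurable_fst]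
  have h : Prod.fst ∘ (fun y : Ω => (y, true)) = id := rfl
  rw [h, Measure.map_id]

/-- The record kernel is a Markov kernel. -/
instance instIsMarkovKernelImhRecord [Fact (Measurable w)] : IsMarkovKernel (imhRecord q w) := by
  have hw : Measurable w := Fact.out
  refine ⟨fun x => ⟨?_⟩⟩
  have h : (imhRecord q w x).map Prod.fst Set.univ = 1 := by
    rw [map_fst_imhRecord hw x]; exact measure_univ
  rwa [Measure.map_apply measurable_fst MeasurableSet.univ, Set.preimage_univ] at h

/-- **Integration against the record from `x`**: for bounded measurable `G : Ω × Bool → ℝ`,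
`∫ G d(imhRecord q w x) = ∫ [a(x,y) G(y, true) + (1 − a(x,y)) G(x, false)] dq(y)`. -/
theorem integral_imhRecord (hw : Measurable w) (hw0 : ∀ x, 0 < w x) {G : Ω × Bool → ℝ}
    (hG : Measurable G) {C : ℝ} (hC : ∀ z, |G z| ≤ C) (x : Ω) :
    ∫ z, G z ∂(imhRecord q w x)
      = ∫ y, (imhAccept w x y * G (y, true) + (1 - imhAccept w x y) * G (x, false)) ∂q := by
  have ham := measurable_imhAccept_right hw x
  have ha0 : ∀ y, 0 ≤ imhAccept w x y := imhAccept_nonneg hw0 x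
  have hab : ∀ y, |imhAccept w x y| ≤ 1 := fun y =>
    abs_le.2 ⟨by linarith [ha0 y], imhAccept_le_one w x y⟩
  have haE : Measurable (imhAcceptE w x) := (measurable_imhAcceptE hw).of_uncurry_left
  have hle : q.withDensity (imhAcceptE w x) ≤ q :=
    (withDensity_mono (ae_of_all _ fun y => imhAcceptE_le_one w x y)).trans_eq withDensity_one
  have hA1 : imhAcceptMass q w x ≤ 1 := imhAcceptMass_le_one q w x
  have hAtop : 1 - imhAcceptMass q w x ≠ ⊤ := ne_top_of_le_ne_top ENNReal.one_ne_top tsub_le_self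
  have hpt : Measurable fun y : Ω => (y, true) := measurable_id'.prodMk measurable_const
  have hGt : Measurable fun y : Ω => G (y, true) := hG.comp hpt
  have hI1 : Integrable G ((q.withDensity (imhAcceptE w x)).map (fun y : Ω => (y, true))) := by
    refine (integrable_map_measure hG.aestronglyMeasurable hpt.aemeasurable).2 ?_
    exact (integrable_of_bounded q hGt (fun y => hC (y, true))).mono_measure hle
  have hI2 : Integrable G ((1 - imhAcceptMass q w x) • Measure.dirac (x, false)) :=
    (integrable_of_bounded (Measure.dirac (x, false)) hG hC).smul_measure hAtop
  have hIa : Integrable (imhAccept w x) q := integrable_of_bounded q ham hab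
  have hIag : Integrable (fun y => imhAccept w x y * G (y, true)) q :=
    integrable_of_bounded q (ham.mul hGt) (C := 1 * C) fun y => by
      rw [abs_mul]; exact mul_le_mul (hab y) (hC (y, true)) (abs_nonneg _) zero_le_one
  have hIrest : Integrable (fun y => (1 - imhAccept w x y) * G (x, false)) q :=
    ((integrable_const 1).sub hIa).mul_const (G (x, false))
  rw [imhRecord_apply_eq hw x, integral_add_measure hI1 hI2,
    integral_map hpt.aemeasurable hG.aestronglyMeasurable,
    integral_withDensity_eq_integral_toReal_smul haE (ae_of_all _ fun y => ENNReal.ofReal_lt_top),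
    integral_smul_measure, integral_dirac' _ _ hG.stronglyMeasurable,
    ENNReal.toReal_sub_of_le hA1 ENNReal.one_ne_top, ENNReal.toReal_one,
    toReal_imhAcceptMass hw hw0, integral_add hIag hIrest, integral_mul_const,
    integral_sub (integrable_const _) hIa, integral_const, probReal_univ, one_smul, smul_eq_mul]
  congr 1
  refine integral_congr_ae (ae_of_all _ fun y => ?_)
  show (imhAcceptE w x y).toReal • G (y, true) = imhAccept w x y * G (y, true)
  rw [imhAcceptE, ENNReal.toReal_ofReal (ha0 y), smul_eq_mul]

/-- A function of the state alone is moved by the flow-MCMC kernel alone: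
`kop K̂ (g ∘ fst) = (kop (indepMH q w) g) ∘ fst`. -/
theorem kop_imhRecord_comp_fst (hw : Measurable w) (hw0 : ∀ x, 0 < w x) {g : Ω → ℝ}
    (hg : Measurable g) {C : ℝ} (hC : ∀ x, |g x| ≤ C) :
    kop (Kernel.prodMkRight Bool (imhRecord q w)) (fun z => g z.1)
      = fun z => kop (indepMH q w) g z.1 := by
  funext z
  show _ = kop (indepMH q w) g z.1
  unfold kop
  rw [Kernel.prodMkRight_apply, integral_imhRecord hw hw0
    (show Measurable (fun z : Ω × Bool => g z.1) from hg.comp measurable_fst) (fun z => hC z.1) z.1,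
    ← kop, kop_indepMH hw hw0 hg hC]

/-- … and so are all its iterates. -/
theorem iterate_kop_imhRecord_comp_fst (hw : Measurable w) (hw0 : ∀ x, 0 < w x) {g : Ω → ℝ}
    (hg : Measurable g) {C : ℝ} (hC : ∀ x, |g x| ≤ C) :
    ∀ t : ℕ, (kop (Kernel.prodMkRight Bool (imhRecord q w)))^[t] (fun z => g z.1)
      = fun z => (kop (indepMH q w))^[t] g z.1
  | 0 => rfl
  | t + 1 => by
    haveI : Fact (Measurable w) := ⟨hw⟩
    obtain ⟨hm, hb⟩ := iterate_kop_bounded_measurable (indepMH q w) hg hC t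
    rw [Function.iterate_succ_apply', iterate_kop_imhRecord_comp_fst hw hw0 hg hC t,
      kop_imhRecord_comp_fst hw hw0 hm hb, Function.iterate_succ_apply']

/-- **The flag's conditional mean is the local acceptance rate of the current state, iterated**:
`(kop K̂)^[t+1] A = ((kop (indepMH q w))^[t] α) ∘ fst`, `α(x) = ∫ min{1, w y / w x} dq(y)`. -/
theorem iterate_kop_imhRecord_acceptFlag (hw : Measurable w) (hw0 : ∀ x, 0 < w x) (t : ℕ) :
    (kop (Kernel.prodMkRight Bool (imhRecord q w)))^[t + 1] acceptFlag
      = fun z => (kop (indepMH q w))^[t] (fun x => (imhAcceptMass q w x).toReal) z.1 := by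
  have h1 : kop (Kernel.prodMkRight Bool (imhRecord q w)) acceptFlag
      = fun z => (imhAcceptMass q w z.1).toReal := by
    funext z
    show _ = (imhAcceptMass q w z.1).toReal
    unfold kop
    rw [Kernel.prodMkRight_apply, integral_imhRecord hw hw0 measurable_acceptFlag
      abs_acceptFlag_le z.1, toReal_imhAcceptMass hw hw0]
    exact integral_congr_ae (ae_of_all _ fun y => by simp [acceptFlag])
  rw [Function.iterate_succ_apply, h1]
  exact iterate_kop_imhRecord_comp_fst hw hw0 (measurable_toReal_imhAcceptMass hw)
    abs_toReal_imhAcceptMass_le t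

variable {π : Measure Ω}

/-- **The record chain is exact for `π̂ = imhRecord q w ∘ₘ π`** (the stationary law of (state, flag
of the move that produced it)) whenever `π` is invariant for the flow-MCMC kernel. -/
theorem imhRecord_invariant (hw : Measurable w) (hinv : Kernel.Invariant (indepMH q w) π) :
    Kernel.Invariant (Kernel.prodMkRight Bool (imhRecord q w)) (imhRecord q w ∘ₘ π) := by
  have hk : (imhRecord q w).map Prod.fst = indepMH q w := by
    ext x s hs
    rw [Kernel.map_apply _ measurable_fst, map_fst_imhRecord hw x]
  show ((imhRecord q w).comap Prod.fst measurable_fst) ∘ₘ (imhRecord q w ∘ₘ π) = imhRecord q w ∘ₘ π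
  rw [← Kernel.comp_deterministic_eq_comap, ← Measure.comp_assoc,
    Measure.deterministic_comp_eq_map, Measure.map_comp _ _ measurable_fst, hk, hinv.def]

/-- **Flag-weighted means: `∫ A(z) H(z.1) dπ̂(z) = ∫ α H dπ`** for bounded measurable `H`
(`∫ a(x,y) H(y) dq(y) = (kop K H)(x) − H(x) + α(x) H(x)` and `∫ kop K H dπ = ∫ H dπ`). -/
theorem integral_acceptFlag_mul (hw : Measurable w) (hw0 : ∀ x, 0 < w x) [IsProbabilityMeasure π]
    (hinv : Kernel.Invariant (indepMH q w) π) {H : Ω → ℝ} (hH : Measurable H) {C : ℝ}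
    (hC : ∀ x, |H x| ≤ C) :
    ∫ z, acceptFlag z * H z.1 ∂(imhRecord q w ∘ₘ π)
      = ∫ x, (imhAcceptMass q w x).toReal * H x ∂π := by
  haveI : Fact (Measurable w) := ⟨hw⟩
  have hFm : Measurable fun z : Ω × Bool => acceptFlag z * H z.1 :=
    measurable_acceptFlag.mul (hH.comp measurable_fst)
  have hFb : ∀ z : Ω × Bool, |acceptFlag z * H z.1| ≤ 1 * C := fun z => by
    rw [abs_mul]; exact mul_le_mul (abs_acceptFlag_le z) (hC z.1) (abs_nonneg _) zero_le_one
  have ham : ∀ x, Measurable (imhAccept w x) := measurable_imhAccept_right hw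
  have hab : ∀ x y, |imhAccept w x y| ≤ 1 := fun x y => by
    rw [abs_of_nonneg (imhAccept_nonneg hw0 x y)]; exact imhAccept_le_one w x y
  have hIa : ∀ x, Integrable (imhAccept w x) q := fun x => integrable_of_bounded q (ham x) (hab x)
  have hIaH : ∀ x, Integrable (fun y => imhAccept w x y * H y) q := fun x =>
    integrable_of_bounded q ((ham x).mul hH) (C := 1 * C) fun y => by
      rw [abs_mul]; exact mul_le_mul (hab x y) (hC y) (abs_nonneg _) zero_le_one
  have hIrest : ∀ x, Integrable (fun y => (1 - imhAccept w x y) * H x) q := fun x =>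
    ((integrable_const 1).sub (hIa x)).mul_const (H x)
  have h2 : ∀ x, ∫ z, acceptFlag z * H z.1 ∂(imhRecord q w x) = ∫ y, imhAccept w x y * H y ∂q :=
    fun x => by
    rw [integral_imhRecord hw hw0 hFm hFb x]
    exact integral_congr_ae (ae_of_all _ fun y => by simp [acceptFlag])
  have h3 : ∀ x, ∫ y, imhAccept w x y * H y ∂q
      = kop (indepMH q w) H x - H x + (imhAcceptMass q w x).toReal * H x := fun x => by
    rw [kop_indepMH hw hw0 hH hC x, toReal_imhAcceptMass hw hw0, integral_add (hIaH x) (hIrest x),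
      integral_mul_const, integral_sub (integrable_const _) (hIa x), integral_const, probReal_univ,
      one_smul]
    ring
  have hIK : Integrable (kop (indepMH q w) H) π :=
    integrable_of_bounded π (measurable_kop _ hH) (abs_kop_le _ hC)
  have hIH : Integrable H π := integrable_of_bounded π hH hC
  have hIKH : Integrable (fun x => kop (indepMH q w) H x - H x) π := hIK.sub hIH
  have hIαH : Integrable (fun x => (imhAcceptMass q w x).toReal * H x) π :=
    integrable_of_bounded π ((measurable_toReal_imhAcceptMass hw).mul hH) (C := 1 * C) fun x => by
      rw [abs_mul]
      exact mul_le_mul (abs_toReal_imhAcceptMass_le x) (hC x) (abs_nonneg _) zero_le_one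
  have hint : Integrable (fun z : Ω × Bool => acceptFlag z * H z.1) (imhRecord q w ∘ₘ π) :=
    integrable_of_bounded _ hFm hFb
  rw [Measure.comp_eq_comp_const_apply] at hint ⊢
  rw [Kernel.integral_comp hint, Kernel.const_apply]
  simp_rw [h2, h3]
  rw [integral_add hIKH hIαH, integral_sub hIK hIH, integral_kop _ hinv hH hC, sub_self, zero_add]

/-- **The mean flag is the mean acceptance**: `E_π̂ A = ∫ α dπ = ā`. -/
theorem integral_acceptFlag (hw : Measurable w) (hw0 : ∀ x, 0 < w x) [IsProbabilityMeasure π]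
    (hinv : Kernel.Invariant (indepMH q w) π) :
    ∫ z, acceptFlag z ∂(imhRecord q w ∘ₘ π) = ∫ x, (imhAcceptMass q w x).toReal ∂π := by
  simpa only [mul_one] using integral_acceptFlag_mul hw hw0 hinv (H := fun _ => (1 : ℝ))
    measurable_const (C := 1) (fun _ => by simp)

/-- **THE RECORD LAW**: `autocov K̂ π̂ A (t + 1) = autocov (indepMH q w) π α t` for every lag `t` —
the flags' lag-`(t+1)` moment is the state chain's lag-`t` moment of the local acceptance rate. -/
theorem autocov_acceptFlag_succ (hw : Measurable w) (hw0 : ∀ x, 0 < w x) [IsProbabilityMeasure π]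
    (hinv : Kernel.Invariant (indepMH q w) π) (t : ℕ) :
    autocov (Kernel.prodMkRight Bool (imhRecord q w)) (imhRecord q w ∘ₘ π) acceptFlag (t + 1)
      = autocov (indepMH q w) π (fun x => (imhAcceptMass q w x).toReal) t := by
  haveI : Fact (Measurable w) := ⟨hw⟩
  obtain ⟨hm, hb⟩ := iterate_kop_bounded_measurable (indepMH q w)
    (measurable_toReal_imhAcceptMass (q := q) hw) abs_toReal_imhAcceptMass_le t
  unfold autocov
  rw [iterate_kop_imhRecord_acceptFlag hw hw0 t]
  exact integral_acceptFlag_mul hw hw0 hinv hm hb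

/-- **THE RECORD LAW, centred** (`ā = ∫ α dπ`): `autocov K̂ π̂ (A − ā) (t + 1) = C_α(t)`. -/
theorem autocov_centred_acceptFlag_succ (hw : Measurable w) (hw0 : ∀ x, 0 < w x)
    [IsProbabilityMeasure π] (hinv : Kernel.Invariant (indepMH q w) π) (t : ℕ) :
    autocov (Kernel.prodMkRight Bool (imhRecord q w)) (imhRecord q w ∘ₘ π)
        (fun z => acceptFlag z - ∫ x, (imhAcceptMass q w x).toReal ∂π) (t + 1)
      = autocov (indepMH q w) π
        (fun x => (imhAcceptMass q w x).toReal - ∫ x, (imhAcceptMass q w x).toReal ∂π) t := by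
  haveI : Fact (Measurable w) := ⟨hw⟩
  rw [autocov_sub_const (imhRecord_invariant hw hinv) measurable_acceptFlag abs_acceptFlag_le _
      (t + 1),
    autocov_sub_const hinv (measurable_toReal_imhAcceptMass hw) abs_toReal_imhAcceptMass_le _ t,
    autocov_acceptFlag_succ hw hw0 hinv t, integral_acceptFlag hw hw0 hinv]

/-- `C_A(0) = ā (1 − ā)` — the single-flag (Bernoulli) variance. -/
theorem autocov_centred_acceptFlag_zero (hw : Measurable w) (hw0 : ∀ x, 0 < w x)
    [IsProbabilityMeasure π] (hinv : Kernel.Invariant (indepMH q w) π) :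
    autocov (Kernel.prodMkRight Bool (imhRecord q w)) (imhRecord q w ∘ₘ π)
        (fun z => acceptFlag z - ∫ x, (imhAcceptMass q w x).toReal ∂π) 0
      = (∫ x, (imhAcceptMass q w x).toReal ∂π) * (1 - ∫ x, (imhAcceptMass q w x).toReal ∂π) := by
  haveI : Fact (Measurable w) := ⟨hw⟩
  rw [autocov_sub_const (imhRecord_invariant hw hinv) measurable_acceptFlag abs_acceptFlag_le _ 0,
    autocov_zero]
  simp_rw [acceptFlag_sq, integral_acceptFlag hw hw0 hinv]
  ring

/-- **Every centred flag autocovariance at lag `≥ 1` is nonnegative** (`indepMH_autocov_nonneg`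
transported): the flags of an exact flow sampler are positively correlated at all lags. -/
theorem autocov_centred_acceptFlag_succ_nonneg (hw : Measurable w) (hw0 : ∀ x, 0 < w x)
    (hwi : Integrable w q) [IsProbabilityMeasure π]
    (hπ : (q.withDensity fun x => ENNReal.ofReal (w x)) = π) (t : ℕ) :
    0 ≤ autocov (Kernel.prodMkRight Bool (imhRecord q w)) (imhRecord q w ∘ₘ π)
        (fun z => acceptFlag z - ∫ x, (imhAcceptMass q w x).toReal ∂π) (t + 1) := by
  have hinv : Kernel.Invariant (indepMH q w) π := hπ ▸ indepMH_invariant hw hw0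
  rw [autocov_centred_acceptFlag_succ hw hw0 hinv t]
  exact indepMH_autocov_nonneg hw hw0 hwi hπ
    ((measurable_toReal_imhAcceptMass hw).sub measurable_const)
    (C := 1 + |∫ x, (imhAcceptMass q w x).toReal ∂π|)
    (fun x => (abs_sub _ _).trans (add_le_add (abs_toReal_imhAcceptMass_le x) le_rfl)) t

section Path
variable [Fact (Measurable w)] [IsProbabilityMeasure π]

variable (q w π) in
/-- The PATH LAW of the record chain `Z = (Z_n)_{n ≥ 0}`, `Z_n = (X_n, A_n)`, started in `π̂`
(Ionescu–Tulcea, Mathlib's `Kernel.trajMeasure`). -/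
abbrev imhRecordPath : Measure (ℕ → Ω × Bool) :=
  Kernel.trajMeasure (X := fun _ : ℕ => Ω × Bool) (imhRecord q w ∘ₘ π)
    (fun n : ℕ => (Kernel.prodMkRight Bool (imhRecord q w)).comap
      (fun h : (i : ↥(Finset.Iic n)) → Ω × Bool => h ⟨n, Finset.mem_Iic.2 le_rfl⟩)
      (measurable_pi_apply _))

/-- **THE VARIANCE OF THE ACCEPTANCE COUNT**: for the record chain started in `π̂` and every `N`,
`Var[Σ_{i<N} A_i] = N ā(1 − ā) + 2 Σ_{t<N} (N − (t+1)) C_α(t)`. -/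
theorem variance_sum_acceptFlag (hw0 : ∀ x, 0 < w x) (hinv : Kernel.Invariant (indepMH q w) π)
    (N : ℕ) :
    Var[fun x : ℕ → Ω × Bool => ∑ i ∈ range N, acceptFlag (x i); imhRecordPath q w π]
      = N * ((∫ x, (imhAcceptMass q w x).toReal ∂π) * (1 - ∫ x, (imhAcceptMass q w x).toReal ∂π))
        + 2 * ∑ t ∈ range N, ((N : ℝ) - (t + 1)) * autocov (indepMH q w) π
            (fun x => (imhAcceptMass q w x).toReal - ∫ x, (imhAcceptMass q w x).toReal ∂π) t := by
  have hw : Measurable w := Fact.out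
  have hinv' := imhRecord_invariant hw hinv
  have key := variance_sum_range_of_cov_eq (μ := imhRecordPath q w π)
    (fun i (x : ℕ → Ω × Bool) => acceptFlag (x i))
    (fun t => autocov (Kernel.prodMkRight Bool (imhRecord q w)) (imhRecord q w ∘ₘ π)
        (fun z => acceptFlag z - ∫ x, (imhAcceptMass q w x).toReal ∂π) t) N
    (fun i _ => chain_memLp (imhRecord q w ∘ₘ π) measurable_acceptFlag abs_acceptFlag_le i)
    (fun i _ j _ => by
      rw [imhRecordPath, chain_covariance hinv' measurable_acceptFlag abs_acceptFlag_le i j,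
        integral_acceptFlag hw hw0 hinv])
  rw [Finset.sum_fn] at key
  rw [key, autocov_centred_acceptFlag_zero hw hw0 hinv]
  congr 1; congr 1
  exact Finset.sum_congr rfl fun t _ => by rw [autocov_centred_acceptFlag_succ hw hw0 hinv t]

/-- **THE ACCEPTANCE RECORD OF AN EXACT FLOW SAMPLER IS SUPER-BINOMIAL**: for every model `q`,
target `π = w · q` (`w > 0` measurable, `q`-integrable), volume and `N`:
`Var[Σ_{i<N} A_i] ≥ N ā (1 − ā)` (`N` i.i.d. coin flips at the chain's own mean acceptance). -/
theorem variance_sum_acceptFlag_ge_binomial (hw0 : ∀ x, 0 < w x) (hwi : Integrable w q)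
    (hπ : (q.withDensity fun x => ENNReal.ofReal (w x)) = π) (N : ℕ) :
    N * ((∫ x, (imhAcceptMass q w x).toReal ∂π) * (1 - ∫ x, (imhAcceptMass q w x).toReal ∂π))
      ≤ Var[fun x : ℕ → Ω × Bool => ∑ i ∈ range N, acceptFlag (x i); imhRecordPath q w π] := by
  have hw : Measurable w := Fact.out
  have hinv : Kernel.Invariant (indepMH q w) π := hπ ▸ indepMH_invariant hw hw0
  rw [variance_sum_acceptFlag hw0 hinv N]
  refine le_add_of_nonneg_right (mul_nonneg zero_le_two (Finset.sum_nonneg fun t ht => ?_))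
  have h1 : ((t : ℝ) + 1) ≤ (N : ℝ) := by exact_mod_cast (Finset.mem_range.mp ht : t + 1 ≤ N)
  have h2 := autocov_centred_acceptFlag_succ_nonneg hw hw0 hwi hπ t
  rw [autocov_centred_acceptFlag_succ hw hw0 hinv t] at h2
  exact mul_nonneg (by linarith) h2

end Path
end Summit.Ventures.LatticeQCDFlow.Scoring
end
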